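import Literature.Analysis.ODE.PathDrivenSecondOrder
import HarnessLib

/-!
# Path-driven ODEs: third-order derivative bounds via the jet of the jet

Topic `Literature/Analysis/ODE`. Sequel to `PathDrivenSecondOrder.lean`. Applying the second-order theorem
`norm_fderiv_fderiv_pathDriven_le` to the JET SYSTEM `G₁(p,(v,w)) = (G(p,v), ∂_vG(p,v)w)` (whose solution family is
the jet family `Φ₁(x,δ) = (Φ x, DΦ(x)δ)`, `jet_solution_family`) bounds the second derivative of the jet family, hence
(δ-slice) the THIRD derivative of the flow `x ↦ Φ x τ` — again by constants depending only on derivative bounds of the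
(jet) field along the solution, not on the driving path (Hartman, *ODE*, Ch. V, Thm. 3.1 / Cor. 4.1, iterated):
* `norm_fderiv_fderiv_jet_le` — `‖D²(q ↦ Φ₁ q τ)(x₀,δ₀)‖ ≤ exp((B₁ + B₂e^{B₁})τ)` from bounds `B₁, B₂` on `∂G₁`, `∂²G₁`
  along the jet solution;
* `norm_fderiv_fderiv_fderiv_pathDriven_apply_le` — `‖D³(x ↦ Φ x τ)(x₀)(dx,dx')(δ₀)‖ ≤ exp((B₁ + B₂e^{B₁})τ)‖dx‖‖dx'‖`.
Everything is PROVED; no definitions, no named facts.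

## References
* P. Hartman, *Ordinary Differential Equations*, SIAM Classics 38 (2002), Ch. V, Thm. 3.1 (PDF p. 95), Cor. 4.1. [Hartman2002]
-/

noncomputable section

open Set Metric Filter Topology Function unitInterval MeasureTheory
open scoped ContDiff NNReal

namespace Literature.Analysis.ODE

universe u

section Jet3

variable {P : Type u} [NormedAddCommGroup P] [NormedSpace ℝ P] [CompleteSpace P]
  {E : Type u} [NormedAddCommGroup E] [NormedSpace ℝ E] [CompleteSpace E]

omit [CompleteSpace P] [CompleteSpace E] in
/-- The jet field of a `C^{n+1}` field is `C^n`. [folklore] -/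
private theorem contDiff_jetField' {n : ℕ∞} {G : P × E → E} (hG : ContDiff ℝ (n + 1 : ℕ∞) G) :
    ContDiff ℝ n fun q : P × (E × E) =>
      (G (q.1, q.2.1), fderiv ℝ G (q.1, q.2.1) ((0 : P), q.2.2)) := by
  have hpr : ContDiff ℝ n fun q : P × (E × E) => ((q.1, q.2.1) : P × E) :=
    contDiff_fst.prodMk (contDiff_fst.comp contDiff_snd)
  have hdir : ContDiff ℝ n fun q : P × (E × E) => (((0 : P), q.2.2) : P × E) :=
    contDiff_const.prodMk (contDiff_snd.comp contDiff_snd)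
  have hn1 : (n : WithTop ℕ∞) + 1 ≤ ((n + 1 : ℕ∞) : WithTop ℕ∞) := le_of_eq (by push_cast; rfl)
  have h2 : ContDiff ℝ n fun q : P × (E × E) => fderiv ℝ G (q.1, q.2.1) ((0 : P), q.2.2) :=
    (hG.contDiff_fderiv_apply hn1).comp (hpr.prodMk hdir)
  exact ((hG.of_le (by exact_mod_cast le_self_add)).comp hpr).prodMk h2

/-- **Second derivative of the jet family.** If along the jet solution from `(x₀, δ₀)` the jet field has
`‖∂G₁(·)(0,u)‖ ≤ B₁‖u‖` and `‖∂²G₁(·)(0,u)(0,u')‖ ≤ B₂‖u‖‖u'‖`, then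
`‖D²(q ↦ Φ₁ q τ)(x₀, δ₀)‖ ≤ exp((B₁ + B₂ e^{B₁}) τ)` (the second-order theorem applied to the jet system).
[cite: Hartman2002, Ch. V Cor. 4.1 (PDF p. 100)] -/
theorem norm_fderiv_fderiv_jet_le {n : ℕ∞} {G : P × E → E} (hG : ContDiff ℝ (n + 1 + 1 : ℕ∞) G)
    (hn : 1 ≤ n) (c : C(I, P)) {Φ : E → C(I, E)}
    (hΦ : ∀ (x : E) (τ : I), Φ x τ = x + ∫ s in (0:ℝ)..(τ:ℝ),
      G (IccExtend zero_le_one c s, IccExtend zero_le_one (Φ x) s))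
    (huniq : ∀ (x : E) (α : C(I, E)), (∀ τ : I, α τ = x + ∫ s in (0:ℝ)..(τ:ℝ),
      G (IccExtend zero_le_one c s, IccExtend zero_le_one α s)) → α = Φ x)
    (x₀ δ₀ : E) {B₁ B₂ : ℝ} (hB₁ : 0 ≤ B₁) (hB₂ : 0 ≤ B₂)
    (hb₁ : ∀ (s : I) (u : E × E),
      ‖fderiv ℝ (fun q : P × (E × E) => (G (q.1, q.2.1), fderiv ℝ G (q.1, q.2.1) ((0 : P), q.2.2)))
        (c s, ((Φ x₀).prodMk (fderiv ℝ Φ x₀ δ₀)) s) ((0 : P), u)‖ ≤ B₁ * ‖u‖)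
    (hb₂ : ∀ (s : I) (u u' : E × E),
      ‖fderiv ℝ (fderiv ℝ (fun q : P × (E × E) => (G (q.1, q.2.1), fderiv ℝ G (q.1, q.2.1) ((0 : P), q.2.2))))
        (c s, ((Φ x₀).prodMk (fderiv ℝ Φ x₀ δ₀)) s) ((0 : P), u) ((0 : P), u')‖ ≤ B₂ * ‖u‖ * ‖u'‖)
    (τ : I) :
    ‖fderiv ℝ (fderiv ℝ (fun q : E × E => ((Φ q.1).prodMk (fderiv ℝ Φ q.1 q.2)) τ)) (x₀, δ₀)‖ ≤
      Real.exp ((B₁ + B₂ * Real.exp B₁) * τ) := by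
  have hG1 : ContDiff ℝ (n + 1 : ℕ∞) G := hG.of_le (by exact_mod_cast le_self_add)
  have hG0 : ContDiff ℝ n G := hG1.of_le (by exact_mod_cast le_self_add)
  have hjet : ContDiff ℝ (n + 1 : ℕ∞) (fun q : P × (E × E) =>
      (G (q.1, q.2.1), fderiv ℝ G (q.1, q.2.1) ((0 : P), q.2.2))) := contDiff_jetField' hG
  obtain ⟨h1, h2⟩ := jet_solution_family hG0 hn c hΦ huniq
  have h := norm_fderiv_fderiv_pathDriven_le (n := n) hjet hn c
    (Φ := fun q : E × E => (Φ q.1).prodMk (fderiv ℝ Φ q.1 q.2)) h1 h2 (x₀, δ₀) hB₁ hB₂ hb₁ hb₂ τ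
  exact h

/-- **Third-derivative bound for the path-driven flow (δ-slice form).** Under the hypotheses of
`norm_fderiv_fderiv_jet_le`: `‖D³(x ↦ Φ x τ)(x₀)(dx)(dx')(δ₀)‖ ≤ exp((B₁ + B₂e^{B₁})τ) ‖dx‖ ‖dx'‖`.
[cite: Hartman2002, Ch. V Cor. 4.1 (PDF p. 100)] -/
theorem norm_fderiv_fderiv_fderiv_pathDriven_apply_le {n : ℕ∞} {G : P × E → E}
    (hG : ContDiff ℝ (n + 1 + 1 : ℕ∞) G) (hn : 1 ≤ n) (c : C(I, P)) {Φ : E → C(I, E)}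
    (hΦ : ∀ (x : E) (τ : I), Φ x τ = x + ∫ s in (0:ℝ)..(τ:ℝ),
      G (IccExtend zero_le_one c s, IccExtend zero_le_one (Φ x) s))
    (huniq : ∀ (x : E) (α : C(I, E)), (∀ τ : I, α τ = x + ∫ s in (0:ℝ)..(τ:ℝ),
      G (IccExtend zero_le_one c s, IccExtend zero_le_one α s)) → α = Φ x)
    (x₀ δ₀ : E) {B₁ B₂ : ℝ} (hB₁ : 0 ≤ B₁) (hB₂ : 0 ≤ B₂)
    (hb₁ : ∀ (s : I) (u : E × E),
      ‖fderiv ℝ (fun q : P × (E × E) => (G (q.1, q.2.1), fderiv ℝ G (q.1, q.2.1) ((0 : P), q.2.2)))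
        (c s, ((Φ x₀).prodMk (fderiv ℝ Φ x₀ δ₀)) s) ((0 : P), u)‖ ≤ B₁ * ‖u‖)
    (hb₂ : ∀ (s : I) (u u' : E × E),
      ‖fderiv ℝ (fderiv ℝ (fun q : P × (E × E) => (G (q.1, q.2.1), fderiv ℝ G (q.1, q.2.1) ((0 : P), q.2.2))))
        (c s, ((Φ x₀).prodMk (fderiv ℝ Φ x₀ δ₀)) s) ((0 : P), u) ((0 : P), u')‖ ≤ B₂ * ‖u‖ * ‖u'‖)
    (τ : I) (dx dx' : E) :
    ‖fderiv ℝ (fderiv ℝ (fderiv ℝ (fun x => Φ x τ))) x₀ dx dx' δ₀‖ ≤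
      Real.exp ((B₁ + B₂ * Real.exp B₁) * τ) * ‖dx‖ * ‖dx'‖ := by
  have hG1 : ContDiff ℝ (n + 1 : ℕ∞) G := hG.of_le (by exact_mod_cast le_self_add)
  have hn1 : (1 : ℕ∞) ≤ n + 1 := le_add_self
  -- smoothness: `Φ` is `C^{n+2}`, the jet family `C^{n+1}`
  have hΦs : ContDiff ℝ (n + 1 + 1 : ℕ∞) Φ := contDiff_pathDriven_solution_family hG le_add_self c hΦ huniq
  have hΦτ : ContDiff ℝ (n + 1 + 1 : ℕ∞) (fun x => Φ x τ) := (ContinuousMap.evalCLM ℝ τ (M := E)).contDiff.comp hΦs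
  have hΦd : Differentiable ℝ Φ := hΦs.differentiable (by simp)
  have hc1 : ContDiff ℝ (n + 1 : ℕ∞) (fderiv ℝ (fun x => Φ x τ)) :=
    hΦτ.fderiv_right (m := (n + 1 : ℕ∞)) (le_of_eq (by push_cast; rfl))
  have hcd : Differentiable ℝ (fderiv ℝ (fun x => Φ x τ)) := hc1.differentiable (by simp)
  have hc2 : ContDiff ℝ n (fderiv ℝ (fderiv ℝ (fun x => Φ x τ))) :=
    hc1.fderiv_right (m := n) (le_of_eq (by push_cast; rfl))
  have hccd : Differentiable ℝ (fderiv ℝ (fderiv ℝ (fun x => Φ x τ))) := hc2.differentiable (by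
    have : n ≠ 0 := by rintro rfl; exact absurd hn (by simp)
    exact_mod_cast this)
  have hjet : ContDiff ℝ (n + 1 : ℕ∞) (fun q : E × E => (Φ q.1).prodMk (fderiv ℝ Φ q.1 q.2)) :=
    contDiff_jet_solution_family hG hn1 c hΦ huniq
  have hJ : ContDiff ℝ (n + 1 : ℕ∞) (fun q : E × E => ((Φ q.1).prodMk (fderiv ℝ Φ q.1 q.2)) τ) :=
    (ContinuousMap.evalCLM ℝ τ (M := E × E)).contDiff.comp hjet
  have hJd : Differentiable ℝ (fun q : E × E => ((Φ q.1).prodMk (fderiv ℝ Φ q.1 q.2)) τ) := hJ.differentiable (by simp)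
  have hJ1 : ContDiff ℝ n (fderiv ℝ (fun q : E × E => ((Φ q.1).prodMk (fderiv ℝ Φ q.1 q.2)) τ)) :=
    hJ.fderiv_right (m := n) (le_of_eq (by push_cast; rfl))
  have hJ1d : Differentiable ℝ (fderiv ℝ (fun q : E × E => ((Φ q.1).prodMk (fderiv ℝ Φ q.1 q.2)) τ)) :=
    hJ1.differentiable (by
      have : n ≠ 0 := by rintro rfl; exact absurd hn (by simp)
      exact_mod_cast this)
  -- `Ψ x = D(Φ · τ)(x) δ₀` is the second component of the jet at `τ` along `x ↦ (x, δ₀)`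
  have hΨ : (fun x => fderiv ℝ (fun x => Φ x τ) x δ₀) =
      fun x => (((fun q : E × E => ((Φ q.1).prodMk (fderiv ℝ Φ q.1 q.2)) τ) (x, δ₀)).2) := by
    funext x
    have h : HasFDerivAt (fun x => Φ x τ) ((ContinuousMap.evalCLM ℝ τ (M := E)).comp (fderiv ℝ Φ x)) x :=
      (ContinuousMap.evalCLM ℝ τ (M := E)).hasFDerivAt.comp x (hΦd x).hasFDerivAt
    show fderiv ℝ (fun x => Φ x τ) x δ₀ = (fderiv ℝ Φ x δ₀) τ
    rw [h.fderiv]; rfl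
  -- the first derivative of `Ψ` as a function: `Λ (DJ(x, δ₀))`, `Λ M = snd ∘ M ∘ inl`
  let Λ : (E × E →L[ℝ] E × E) →L[ℝ] (E →L[ℝ] E) :=
    ((ContinuousLinearMap.compL ℝ E (E × E) E) (ContinuousLinearMap.snd ℝ E E)).comp
      ((ContinuousLinearMap.compL ℝ E (E × E) (E × E)).flip (ContinuousLinearMap.inl ℝ E E))
  have hΛ : ∀ M : E × E →L[ℝ] E × E,
      Λ M = (ContinuousLinearMap.snd ℝ E E).comp (M.comp (ContinuousLinearMap.inl ℝ E E)) := fun M => by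
    simp [Λ]
  have hsnd : ‖ContinuousLinearMap.snd ℝ E E‖ ≤ 1 :=
    ContinuousLinearMap.opNorm_le_bound _ zero_le_one fun x => by simpa using norm_snd_le x
  have hΛn : ‖Λ‖ ≤ 1 := by
    refine ContinuousLinearMap.opNorm_le_bound _ zero_le_one fun M => ?_
    rw [hΛ, one_mul]
    refine (ContinuousLinearMap.opNorm_comp_le _ _).trans ?_
    refine (mul_le_mul hsnd (ContinuousLinearMap.opNorm_comp_le _ _)
      (norm_nonneg _) zero_le_one).trans ?_
    rw [one_mul]
    exact mul_le_of_le_one_right (norm_nonneg M) (ContinuousLinearMap.norm_inl_le_one ℝ E E)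
  have hD1 : ∀ x, HasFDerivAt (fun x => fderiv ℝ (fun x => Φ x τ) x δ₀)
      (Λ (fderiv ℝ (fun q : E × E => ((Φ q.1).prodMk (fderiv ℝ Φ q.1 q.2)) τ) (x, δ₀))) x := by
    intro x
    rw [hΨ, hΛ]
    have hin : HasFDerivAt (fun x : E => (x, δ₀)) (ContinuousLinearMap.inl ℝ E E) x :=
      hasFDerivAt_prodMk_left (𝕜 := ℝ) x δ₀
    exact (ContinuousLinearMap.snd ℝ E E).hasFDerivAt.comp x (((hJd (x, δ₀)).hasFDerivAt).comp x hin)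
  have hD1f : fderiv ℝ (fun x => fderiv ℝ (fun x => Φ x τ) x δ₀) =
      fun x => Λ (fderiv ℝ (fun q : E × E => ((Φ q.1).prodMk (fderiv ℝ Φ q.1 q.2)) τ) (x, δ₀)) :=
    funext fun x => (hD1 x).fderiv
  -- the second derivative of `Ψ`
  have hD2 : HasFDerivAt (fderiv ℝ (fun x => fderiv ℝ (fun x => Φ x τ) x δ₀))
      (Λ.comp ((fderiv ℝ (fderiv ℝ (fun q : E × E => ((Φ q.1).prodMk (fderiv ℝ Φ q.1 q.2)) τ)) (x₀, δ₀)).comp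
        (ContinuousLinearMap.inl ℝ E E))) x₀ := by
    rw [hD1f]
    have hin : HasFDerivAt (fun x : E => (x, δ₀)) (ContinuousLinearMap.inl ℝ E E) x₀ :=
      hasFDerivAt_prodMk_left (𝕜 := ℝ) x₀ δ₀
    exact Λ.hasFDerivAt.comp x₀ (((hJ1d (x₀, δ₀)).hasFDerivAt).comp x₀ hin)
  have hnormD2 : ‖fderiv ℝ (fderiv ℝ (fun x => fderiv ℝ (fun x => Φ x τ) x δ₀)) x₀‖ ≤
      Real.exp ((B₁ + B₂ * Real.exp B₁) * τ) := by
    rw [hD2.fderiv]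
    refine (ContinuousLinearMap.opNorm_comp_le _ _).trans ?_
    refine (mul_le_mul hΛn (ContinuousLinearMap.opNorm_comp_le _ _) (norm_nonneg _) zero_le_one).trans ?_
    rw [one_mul]
    refine (mul_le_of_le_one_right (norm_nonneg _) (ContinuousLinearMap.norm_inl_le_one ℝ E E)).trans ?_
    exact norm_fderiv_fderiv_jet_le hG hn c hΦ huniq x₀ δ₀ hB₁ hB₂ hb₁ hb₂ τ
  -- identification with the third derivative of `x ↦ Φ x τ`
  have hΨ' : (fun x => fderiv ℝ (fun x => Φ x τ) x δ₀) =
      fun x => (ContinuousLinearMap.apply ℝ E δ₀) (fderiv ℝ (fun x => Φ x τ) x) := by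
    funext x; simp
  have hE1 : fderiv ℝ (fun x => fderiv ℝ (fun x => Φ x τ) x δ₀) =
      fun x => (ContinuousLinearMap.apply ℝ E δ₀).comp (fderiv ℝ (fderiv ℝ (fun x => Φ x τ)) x) := by
    funext x
    rw [hΨ']
    exact ((ContinuousLinearMap.apply ℝ E δ₀).hasFDerivAt.comp x (hcd x).hasFDerivAt).fderiv
  have hE2 : fderiv ℝ (fderiv ℝ (fun x => fderiv ℝ (fun x => Φ x τ) x δ₀)) x₀ =
      ((ContinuousLinearMap.compL ℝ E (E →L[ℝ] E) E) (ContinuousLinearMap.apply ℝ E δ₀)).comp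
        (fderiv ℝ (fderiv ℝ (fderiv ℝ (fun x => Φ x τ))) x₀) := by
    rw [hE1]
    exact (((ContinuousLinearMap.compL ℝ E (E →L[ℝ] E) E) (ContinuousLinearMap.apply ℝ E δ₀)).hasFDerivAt.comp x₀
      (hccd x₀).hasFDerivAt).fderiv
  have hval : fderiv ℝ (fderiv ℝ (fderiv ℝ (fun x => Φ x τ))) x₀ dx dx' δ₀ =
      fderiv ℝ (fderiv ℝ (fun x => fderiv ℝ (fun x => Φ x τ) x δ₀)) x₀ dx dx' := by
    rw [hE2]; simp
  rw [hval]
  calc ‖fderiv ℝ (fderiv ℝ (fun x => fderiv ℝ (fun x => Φ x τ) x δ₀)) x₀ dx dx'‖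
      ≤ ‖fderiv ℝ (fderiv ℝ (fun x => fderiv ℝ (fun x => Φ x τ) x δ₀)) x₀ dx‖ * ‖dx'‖ :=
        ContinuousLinearMap.le_opNorm _ _
    _ ≤ (‖fderiv ℝ (fderiv ℝ (fun x => fderiv ℝ (fun x => Φ x τ) x δ₀)) x₀‖ * ‖dx‖) * ‖dx'‖ :=
        mul_le_mul_of_nonneg_right (ContinuousLinearMap.le_opNorm _ _) (norm_nonneg _)
    _ ≤ Real.exp ((B₁ + B₂ * Real.exp B₁) * τ) * ‖dx‖ * ‖dx'‖ := by
        gcongr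

end Jet3
end Literature.Analysis.ODE
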